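import Summits.NavierStokesRegularity.NavierStokesRegularity.Theses.RellichScar
import Summits.NavierStokesRegularity.NavierStokesRegularity.Theorems.SymmetricScarExists.Negative.SpiralWorld
import Summits.NavierStokesRegularity.NavierStokesRegularity.Theorems.RellichScarNoMildScarZoom

/-!
# Crux `SymmetricScarExists` (stmt-NavierStokesRegularity-11718), line `analytic-scar-window-rigidity`:
# stub `stub_scaleWindowRigidity` — a window of scar-preserving scales forces a homogeneous scar

The registered stub `stub_scaleWindowRigidity` of the line's skeleton.  The SCAR of a field
`u : ℝ → ℝ³ → ℝ³` is its trace at the final time `0` off the origin, compared through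
`SameScar u v` (`esssup_{(−δ,0)×K} ‖u − v‖ → 0` as `δ ↓ 0` for every compact `K ∌ 0`);
`HomScar u` says that every parabolic rescaling `u_λ(t,x) = λ u(λ²t, λx)` (`nsRescale λ u`),
`λ > 0`, has the same scar as `u`.  We prove the purely group-theoretic upgrade: if
`SameScar (nsRescale λ u) u` for all `λ` in a window `[a, b]`, `0 < a < b`, then `HomScar u`.

* `SameScar` is an equivalence relation (`sameScar_refl` of the tree, `sameScar_symm`,
  `sameScar_trans` — triangle inequality for the essential supremum, no measurability needed);
* it is covariant under the rescaling (`sameScar_nsRescale`): the change of variables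
  `(t,x) ↦ (λ²t, λx)` maps `(−δ,0)×K` onto `(−λ²δ,0)×λK` and transports the essential supremum up to
  the amplitude factor `λ` — the tree's `zoom_scar_tendsto` applied to the field `u − v` with zero
  scar;
* hence the log-scales `{x : ℝ | SameScar (nsRescale eˣ u) u}` form an additive subgroup of `ℝ`
  (group law `nsRescale_mul`); it contains the interval `[log a, log b]`, so it is open
  (`AddSubgroup.isOpen_of_mem_nhds`), hence clopen (`AddSubgroup.isClosed_of_isOpen`), hence all
  of `ℝ` (`ℝ` is connected, `IsClopen.eq_univ`).

Helper file for the crux item (lands `--supports stmt-NavierStokesRegularity-11718`).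
-/

noncomputable section

open MeasureTheory Set Function Filter Topology TopologicalSpace Metric
open scoped NNReal ENNReal

namespace Summit.NavierStokesRegularity.NavierStokesRegularity.Theorems.SymmetricScarExists.ScarWindow

open Literature.Analysis.FluidPDE
open Summit.NavierStokesRegularity.NavierStokesRegularity.Theses.RellichScar
open Summit.NavierStokesRegularity.NavierStokesRegularity.Theorems.SymmetricScarExists.Negative
open Summit.NavierStokesRegularity.NavierStokesRegularity.Theorems.RellichScarNoMildScar
  (zoom_scar_tendsto)

set_option linter.dupNamespace false

variable {u v w : ℝ → (EuclideanSpace ℝ (Fin 3)) → (EuclideanSpace ℝ (Fin 3))}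

/-! ### `SameScar` is an equivalence relation -/

/-- `SameScar` is symmetric (`‖v − u‖ = ‖u − v‖` pointwise). [folklore] -/
theorem sameScar_symm (h : SameScar u v) : SameScar v u := by
  intro K hK h0
  have hneg : uncurry v - uncurry u = -(uncurry u - uncurry v) := (neg_sub _ _).symm
  simp_rw [hneg, eLpNorm_neg]
  exact h K hK h0

/-- Triangle inequality for the scar functional: essential suprema of a difference split through
an intermediate field (no measurability is needed in `L^∞`). [folklore] -/
theorem eLpNorm_top_sub_le_add
    (f g h : ℝ × (EuclideanSpace ℝ (Fin 3)) → (EuclideanSpace ℝ (Fin 3)))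
    (μ : Measure (ℝ × (EuclideanSpace ℝ (Fin 3)))) :
    eLpNorm (f - h) ⊤ μ ≤ eLpNorm (f - g) ⊤ μ + eLpNorm (g - h) ⊤ μ := by
  have hsplit : f - h = (f - g) + (g - h) := (sub_add_sub_cancel f g h).symm
  rw [hsplit, eLpNorm_exponent_top, eLpNorm_exponent_top, eLpNorm_exponent_top]
  exact eLpNormEssSup_add_le

/-- `SameScar` is transitive (squeeze with the triangle inequality). [folklore] -/
theorem sameScar_trans (h₁ : SameScar u v) (h₂ : SameScar v w) : SameScar u w := by
  intro K hK h0
  have hsum := (h₁ K hK h0).add (h₂ K hK h0)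
  rw [add_zero] at hsum
  exact tendsto_of_tendsto_of_tendsto_of_le_of_le tendsto_const_nhds hsum (fun _ => zero_le)
    fun _ => eLpNorm_top_sub_le_add _ (uncurry v) _ _

/-! ### Covariance of the scar under the parabolic rescaling -/

/-- **The scar relation is covariant under the rescaling**: `SameScar u v → SameScar u_c v_c` for
`c > 0`.  Change of variables `(t, x) ↦ (c² t, c x)`:
`‖u_c − v_c‖_{L^∞((−δ,0)×K)} = c ‖u − v‖_{L^∞((−c²δ,0)×cK)}`, `cK` is compact with `0 ∉ cK`, and
`δ ↦ c²δ` preserves `δ ↓ 0` — the tree's `zoom_scar_tendsto` for the field `u − v` with zero scar,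
read through `c • stPull (c²) c 0 0 = nsRescale c`. [folklore] -/
theorem sameScar_nsRescale (h : SameScar u v) {c : ℝ} (hc : 0 < c) :
    SameScar (nsRescale c u) (nsRescale c v) := by
  intro K hK h0
  have hscar : ∀ K : Set (EuclideanSpace ℝ (Fin 3)), IsCompact K →
      (0 : EuclideanSpace ℝ (Fin 3)) ∉ K →
      Tendsto (fun δ : ℝ => eLpNorm (fun z : ℝ × (EuclideanSpace ℝ (Fin 3)) =>
        (u - v) z.1 z.2 - (0 : (EuclideanSpace ℝ (Fin 3)) → (EuclideanSpace ℝ (Fin 3))) z.2) ⊤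
        (volume.restrict (Ioo (-δ) 0 ×ˢ K))) (𝓝[>] 0) (𝓝 0) := by
    intro K hK h0
    have hfun : (fun z : ℝ × (EuclideanSpace ℝ (Fin 3)) =>
        (u - v) z.1 z.2 - (0 : (EuclideanSpace ℝ (Fin 3)) → (EuclideanSpace ℝ (Fin 3))) z.2) =
        uncurry u - uncurry v := by
      funext z
      simp only [Pi.sub_apply, Pi.zero_apply, sub_zero, Function.uncurry_def]
    rw [hfun]
    exact h K hK h0
  have key := zoom_scar_tendsto (u := u - v) (σ := 0) hc hscar hK h0
  have hfun : (fun z : ℝ × (EuclideanSpace ℝ (Fin 3)) =>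
      (c • stPull (c ^ 2) c 0 (0 : EuclideanSpace ℝ (Fin 3)) (u - v)) z.1 z.2 -
        c • (0 : (EuclideanSpace ℝ (Fin 3)) → (EuclideanSpace ℝ (Fin 3))) (c • z.2)) =
      uncurry (nsRescale c u) - uncurry (nsRescale c v) := by
    funext z
    simp only [smul_stPull_apply, zero_add, Pi.sub_apply, Pi.zero_apply, smul_zero, sub_zero,
      smul_sub, Function.uncurry_def, nsRescale_apply]
  rw [hfun] at key
  exact key

/-! ### Window rigidity -/

/-- **Scale-window rigidity.**  If the scar of `u` is invariant under the rescalings `λ ∈ [a, b]`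
(`0 < a < b`), it is invariant under every rescaling `λ > 0`: the log-scales preserving the scar
form an additive subgroup of `ℝ` (reflexivity, symmetry, transitivity and covariance of `SameScar`,
group law `nsRescale (c d) = nsRescale d ∘ nsRescale c`) containing the interval `[log a, log b]`,
hence open, hence closed, hence — `ℝ` being connected — all of `ℝ`. [folklore] -/
theorem stub_scaleWindowRigidity :
    ∀ (u : ℝ → EuclideanSpace ℝ (Fin 3) → EuclideanSpace ℝ (Fin 3)) (a b : ℝ), 0 < a → a < b →
      (∀ lam ∈ Icc a b, SameScar (nsRescale lam u) u) → HomScar u := by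
  intro u a b ha hab hwin lam hlam
  -- the stabiliser of the scar in log-scale, an additive subgroup of `ℝ`
  let H : AddSubgroup ℝ :=
    { carrier := {x : ℝ | SameScar (nsRescale (Real.exp x) u) u}
      zero_mem' := by
        show SameScar (nsRescale (Real.exp 0) u) u
        rw [Real.exp_zero, nsRescale_one]
        exact sameScar_refl u
      add_mem' := by
        intro x y hx hy
        show SameScar (nsRescale (Real.exp (x + y)) u) u
        rw [Real.exp_add, nsRescale_mul]
        exact sameScar_trans (sameScar_nsRescale hx (Real.exp_pos y)) hy
      neg_mem' := by
        intro x hx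
        show SameScar (nsRescale (Real.exp (-x)) u) u
        have h1 := sameScar_nsRescale hx (Real.exp_pos (-x))
        rw [← nsRescale_mul, ← Real.exp_add, add_neg_cancel, Real.exp_zero, nsRescale_one] at h1
        exact sameScar_symm h1 }
  have hH : ∀ x : ℝ, x ∈ (H : Set ℝ) ↔ SameScar (nsRescale (Real.exp x) u) u := fun x => Iff.rfl
  -- it contains the window `[log a, log b]`, a neighbourhood of its midpoint
  have hIcc : Icc (Real.log a) (Real.log b) ⊆ (H : Set ℝ) := by
    intro x hx
    rw [hH]
    refine hwin _ ⟨?_, ?_⟩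
    · calc a = Real.exp (Real.log a) := (Real.exp_log ha).symm
        _ ≤ Real.exp x := Real.exp_le_exp.2 hx.1
    · calc Real.exp x ≤ Real.exp (Real.log b) := Real.exp_le_exp.2 hx.2
        _ = b := Real.exp_log (ha.trans hab)
  have hlog : Real.log a < Real.log b := Real.log_lt_log ha hab
  have hnhds : (H : Set ℝ) ∈ 𝓝 ((Real.log a + Real.log b) / 2) :=
    mem_of_superset (Icc_mem_nhds (by linarith) (by linarith)) hIcc
  -- hence it is open, closed, and (by connectedness of `ℝ`) everything
  have hopen : IsOpen (H : Set ℝ) := H.isOpen_of_mem_nhds hnhds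
  have huniv : (H : Set ℝ) = univ :=
    IsClopen.eq_univ ⟨H.isClosed_of_isOpen hopen, hopen⟩ ⟨0, H.zero_mem⟩
  have hmem : SameScar (nsRescale (Real.exp (Real.log lam)) u) u :=
    (hH _).1 (Set.eq_univ_iff_forall.1 huniv (Real.log lam))
  rwa [Real.exp_log hlam] at hmem

end Summit.NavierStokesRegularity.NavierStokesRegularity.Theorems.SymmetricScarExists.ScarWindow

end
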